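import Summits.ResolutionOfSingularities.ResolutionOfSingularities.Theorems.PurelyInseparableDim4JointHereditaryChild
import HarnessLib

/-!
# Purely inseparable four-folds: ALL CHILDREN of a blown-up coordinate member WITH THEIR HEREDITARY WAITING REGIONS, through a
# given comparison `ε` (brick S3 (c) «joint point∘coordinate chains», part 61c = v3-H, children side of the step; cell `res-dim4-pi`)

[OURS · counted 0] (D-0157 DOOR 2; desk WORD #66 (4)(c), #74 (g), #99 (d); frame `PIDim4.TerminationImpliesOrderReduction`, S3 (c)
v3-H; host item stmt-ResolutionOfSingularities-16155, helper). Nothing here proves resolution of singularities in dimension ≥ 4 /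
characteristic `p` — NOT here, not anywhere in this programme.

Part 37c (`joint_forest_kids_model`: the children of a blown-up coordinate member through a given `ε`, their data, model descriptions
and pairwise disjointness) with part 61b's HEREDITARY WAITING REGIONS added: every child `e = (j, b, S″) ∈ Pl` carries the finite set
`Hd e` of its hereditary waiting entries `(j″, c, T)` (`c_j = 0`, `c|_S = 0`, `S ∖ {j} ⊆ T ∋ j`) and gets closed regions `rgn e wt`
read through its own zigzag chart (the `MemberChartZ` clause), over the parent, with MODEL DESCRIPTIONS re-centred at `b + c` (so that
typ-2's chart-centre lemmas — disjointness, membership tests — apply to regions verbatim); the pairwise DISJOINTNESS child/child (P2),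
region/other child (H2a), region/region (H2c) in `W`; and, when every old boundary component meeting the parent contains it, the
model-free boundary invariants of part 60 for every child and region.

* **`joint_forest_children_hereditary`**.

AI-produced formalisation, weaker than expert review. bears_on: LADDER-RESOLUTION:D157-DOOR2 (res-dim4-pi · S3 (c) joint v3-H · children).
-/

set_option linter.dupNamespace false -- D-0017: single-problem summit path `Summit.<S>.<S>.…` by design

noncomputable section

open MvPolynomial Finset CategoryTheory AlgebraicGeometry Opposite TopologicalSpace
open AlgebraicGeometry.Scheme.IdealSheafData (ofIdealTop vanishingIdeal)

namespace Summit.ResolutionOfSingularities.ResolutionOfSingularities.Theorems.PIDim4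

open Literature.AlgebraicGeometry.Resolution
open Literature.AlgebraicGeometry.Resolution.Hauser2010
open Literature.AlgebraicGeometry.Resolution.AffinePointBlowup (P A γ coord Wtop ξ)

namespace Equimultiple

section ChildrenH

variable {K : Type} [Field K] {p : ℕ} [hp : Fact p.Prime] [CharP K p] [DecidableEq K]
variable {Z Y W Bl : Scheme.{0}} (φ : Y ⟶ Z) [IsOpenImmersion φ] (ψ : Y ⟶ P 4 K) [IsOpenImmersion ψ]
  {π : W ⟶ Z} {B : Bl ⟶ P 4 K} {S : Finset (Fin 4)}
  (ε : (π ⁻¹ᵁ φ.opensRange : Scheme.{0}) ≅ (B ⁻¹ᵁ ψ.opensRange : Scheme.{0}))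

/-- **One child with its hereditary regions, REORDERED** (part 61b's `child_package_hereditary` with the re-centring `Θ` last, so that
consumers name it by `obtain` instead of `Exists.choose`). [cite: BierstoneGrigorievMilmanWlodarczyk2011, Def. 3.1.3 (1)–(2), (4)] -/
theorem child_package_hereditary₂ [IsLocallyNoetherian Z] [IsAlgClosed K] (Zc : Z.IdealSheafData)
    (hπ : IsBlowup π Zc) (hB : IsBlowup B (AffineCoordBlowup.𝓘Λ 4 K (insert 0 (Fin.succ '' (S : Set (Fin 4))))))
    (hsq : ε.hom ≫ (B ∣_ ψ.opensRange) = (π ∣_ φ.opensRange) ≫ (φ.isoOpensRange.inv ≫ ψ.isoOpensRange.hom))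
    (hC' : ((AffineCoordBlowup.𝓘Λ 4 K (insert 0 (Fin.succ '' (S : Set (Fin 4))))).comap ψ.opensRange.ι).comap
        (φ.isoOpensRange.inv ≫ ψ.isoOpensRange.hom) = Zc.comap φ.opensRange.ι)
    (M : MarkedIdeal Z) (hmult : M.mult = p) (s : State K)
    (hK : ((controlledTransform B (AffineCoordBlowup.𝓘Λ 4 K (insert 0 (Fin.succ '' (S : Set (Fin 4)))))
        (hypSheaf p s.F) p).comap (B ⁻¹ᵁ ψ.opensRange).ι).comap ε.hom =
      (controlledTransform π Zc M.ideal p).comap (π ⁻¹ᵁ φ.opensRange).ι) (hS : IsPermissibleCentre p S s.F)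
    (hsee : (AffineCoordBlowup.CΛ 4 K (insert 0 (Fin.succ '' (S : Set (Fin 4)))) : Set (P 4 K)) ⊆ Set.range ψ) (hT : IsClosed (φ '' (ψ ⁻¹' (AffineCoordBlowup.CΛ 4 K (insert 0 (Fin.succ '' (S : Set (Fin 4)))) : Set (P 4 K)))))
    (hsncZ : HasSNCWith M.boundary Zc) (idx : Z.IdealSheafData → Fin 4) (cst : Z.IdealSheafData → K)
    (hshape : ∀ D ∈ M.boundary, ((D.support : Set Z) ∩ φ '' (ψ ⁻¹' (AffineCoordBlowup.CΛ 4 K (insert 0 (Fin.succ '' (S : Set (Fin 4)))) : Set (P 4 K)))).Nonempty →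
      D.comap φ = (ofIdealTop (Ideal.span {(γ 4 K).symm (X (idx D).succ + C (cst D))})).comap ψ ∧
        (idx D ∈ S → cst D = 0))
    (hinj : ∀ D₁ ∈ M.boundary, ∀ D₂ ∈ M.boundary,
      ((D₁.support : Set Z) ∩ φ '' (ψ ⁻¹' (AffineCoordBlowup.CΛ 4 K (insert 0 (Fin.succ '' (S : Set (Fin 4)))) : Set (P 4 K)))).Nonempty → ((D₂.support : Set Z) ∩ φ '' (ψ ⁻¹' (AffineCoordBlowup.CΛ 4 K (insert 0 (Fin.succ '' (S : Set (Fin 4)))) : Set (P 4 K)))).Nonempty →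
      idx D₁ = idx D₂ → D₁ = D₂)
    (Pl : Finset (Fin 4 × (Fin 4 → K) × Finset (Fin 4)))
    (hP1 : ∀ e ∈ Pl, e.1 ∈ S ∧ e.2.1 e.1 = 0 ∧ S ⊆ e.2.2 ∧ CentreBlowup.IsEquimultiplePoint p S e.1 e.2.1 s ∧
      IsPermissibleCentre p e.2.2 (CentreBlowup.step p S e.1 e.2.1 s).F)
    (Hd : Fin 4 × (Fin 4 → K) × Finset (Fin 4) → Finset (Fin 4 × (Fin 4 → K) × Finset (Fin 4)))
    (hH1 : ∀ e ∈ Pl, ∀ wt ∈ Hd e, wt.2.1 e.1 = 0 ∧ (∀ i ∈ S, wt.2.1 i = 0) ∧ S.erase e.1 ⊆ wt.2.2 ∧ e.1 ∈ wt.2.2)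
    {e : Fin 4 × (Fin 4 → K) × Finset (Fin 4)} (he : e ∈ Pl) :
    ∃ (c'' : Closeds W) (rg : Fin 4 × (Fin 4 → K) × Finset (Fin 4) → Closeds W),
        Scheme.IsRegular (vanishingIdeal c'').subscheme ∧
        HasSNCWith (M.transform π Zc).boundary (vanishingIdeal c'') ∧
        (∃ (Y'' : Scheme.{0}) (φ'' : Y'' ⟶ W) (ψ'' : Y'' ⟶ P 4 K) (_ : IsOpenImmersion φ'') (_ : IsOpenImmersion ψ''),
          (M.transform π Zc).ideal.comap φ'' = (hypSheaf p (CentreBlowup.step p S e.1 e.2.1 s).F).comap ψ'' ∧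
          (vanishingIdeal c'').comap φ'' =
            (AffineCoordBlowup.𝓘Λ 4 K (insert 0 (Fin.succ '' ((e.2.2 : Finset (Fin 4)) : Set (Fin 4))))).comap ψ'' ∧
          (c'' : Set W) ⊆ Set.range φ'' ∧
          (AffineCoordBlowup.CΛ 4 K (insert 0 (Fin.succ '' ((e.2.2 : Finset (Fin 4)) : Set (Fin 4)))) : Set (P 4 K)) ⊆ Set.range ψ'' ∧
          (∃ (idx₂ : W.IdealSheafData → Fin 4) (cst₂ : W.IdealSheafData → K),
            (∀ D₂ ∈ (M.transform π Zc).boundary,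
              ((D₂.support : Set W) ∩ φ'' '' (ψ'' ⁻¹' (AffineCoordBlowup.CΛ 4 K (insert 0 (Fin.succ '' ((e.2.2 : Finset (Fin 4)) : Set (Fin 4)))) : Set (P 4 K)))).Nonempty →
              D₂.comap φ'' = (ofIdealTop (Ideal.span {(γ 4 K).symm (X (idx₂ D₂).succ + C (cst₂ D₂))})).comap ψ'' ∧
                (idx₂ D₂ ∈ e.2.2 → cst₂ D₂ = 0)) ∧
            (∀ D₁ ∈ (M.transform π Zc).boundary, ∀ D₂ ∈ (M.transform π Zc).boundary,
              ((D₁.support : Set W) ∩ φ'' '' (ψ'' ⁻¹' (AffineCoordBlowup.CΛ 4 K (insert 0 (Fin.succ '' ((e.2.2 : Finset (Fin 4)) : Set (Fin 4)))) : Set (P 4 K)))).Nonempty →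
              ((D₂.support : Set W) ∩ φ'' '' (ψ'' ⁻¹' (AffineCoordBlowup.CΛ 4 K (insert 0 (Fin.succ '' ((e.2.2 : Finset (Fin 4)) : Set (Fin 4)))) : Set (P 4 K)))).Nonempty →
              idx₂ D₁ = idx₂ D₂ → D₁ = D₂)) ∧
          ∀ wt ∈ Hd e, (rg wt : Set W) = φ'' '' (ψ'' ⁻¹' {x : P 4 K | (X 0 : A 4 K) ∈ x.asIdeal ∧ ∀ i ∈ wt.2.2, (X i.succ - C (wt.2.1 i) : A 4 K) ∈ x.asIdeal}) ∧ {x : P 4 K | (X 0 : A 4 K) ∈ x.asIdeal ∧ ∀ i ∈ wt.2.2, (X i.succ - C (wt.2.1 i) : A 4 K) ∈ x.asIdeal} ⊆ Set.range ψ'') ∧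
        (c'' : Set W) ⊆ π ⁻¹' (φ '' (ψ ⁻¹' (AffineCoordBlowup.CΛ 4 K (insert 0 (Fin.succ '' (S : Set (Fin 4)))) : Set (P 4 K)))) ∧
        (c'' : Set W).Nonempty ∧
        (∀ wt ∈ Hd e, (rg wt : Set W) ⊆ π ⁻¹' (φ '' (ψ ⁻¹' (AffineCoordBlowup.CΛ 4 K (insert 0 (Fin.succ '' (S : Set (Fin 4)))) : Set (P 4 K))))) ∧
        ((∀ D ∈ M.boundary, ((D.support : Set Z) ∩ φ '' (ψ ⁻¹' (AffineCoordBlowup.CΛ 4 K (insert 0 (Fin.succ '' (S : Set (Fin 4)))) : Set (P 4 K)))).Nonempty → idx D ∈ S) →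
          (∀ D₂ ∈ (M.transform π Zc).boundary, ((D₂.support : Set W) ∩ (c'' : Set W)).Nonempty →
            (c'' : Set W) ⊆ D₂.support) ∧
          (∀ wt ∈ Hd e, ∀ D₂ ∈ (M.transform π Zc).boundary,
            Disjoint (D₂.support : Set W) (rg wt : Set W) ∨
              ((c'' : Set W) ⊆ D₂.support ∧ (rg wt : Set W) ⊆ D₂.support))) ∧
        ∃ Θ : A 4 K ≃ₐ[K] A 4 K, (∀ i : Fin 4, Θ (X i.succ) = X i.succ + C (e.2.1 i)) ∧
          (controlledTransform B (AffineCoordBlowup.𝓘Λ 4 K (insert 0 (Fin.succ '' (S : Set (Fin 4))))) (hypSheaf p s.F) p).comap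
              (Spec.map (CommRingCat.ofHom ((Θ : A 4 K ≃ₐ[K] A 4 K) : A 4 K →+* A 4 K)) ≫
              AffineCoordBlowup.chartImm hB (ChartDictionary.succ_mem_centreVars (hP1 e he).1)) = hypSheaf p (CentreBlowup.step p S e.1 e.2.1 s).F ∧
          (∀ (w : W) (hwV : w ∈ π ⁻¹ᵁ φ.opensRange), w ∈ (c'' : Set W) ↔
            ((B ⁻¹ᵁ ψ.opensRange).ι (ε.hom ⟨w, hwV⟩) : Bl) ∈ (Spec.map (CommRingCat.ofHom ((Θ : A 4 K ≃ₐ[K] A 4 K) : A 4 K →+* A 4 K)) ≫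
              AffineCoordBlowup.chartImm hB (ChartDictionary.succ_mem_centreVars (hP1 e he).1)) '' (AffineCoordBlowup.CΛ 4 K (insert 0 (Fin.succ '' ((e.2.2 : Finset (Fin 4)) : Set (Fin 4)))) : Set (P 4 K))) ∧
          ∀ wt ∈ Hd e,
            (∀ (w : W) (hwV : w ∈ π ⁻¹ᵁ φ.opensRange), w ∈ (rg wt : Set W) ↔
              ((B ⁻¹ᵁ ψ.opensRange).ι (ε.hom ⟨w, hwV⟩) : Bl) ∈ (Spec.map (CommRingCat.ofHom ((Θ.trans (AffinePointBlowup.translateEquiv (n := 4) (Fin.cases 0 wt.2.1)) : A 4 K ≃ₐ[K] A 4 K) : A 4 K →+* A 4 K)) ≫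
              AffineCoordBlowup.chartImm hB (ChartDictionary.succ_mem_centreVars (hP1 e he).1)) '' (AffineCoordBlowup.CΛ 4 K (insert 0 (Fin.succ '' ((wt.2.2 : Finset (Fin 4)) : Set (Fin 4)))) : Set (P 4 K))) ∧
            (∀ i : Fin 4, (Θ.trans (AffinePointBlowup.translateEquiv (n := 4) (Fin.cases 0 wt.2.1))) (X i.succ) = X i.succ + C (e.2.1 i + wt.2.1 i)) ∧
            (controlledTransform B (AffineCoordBlowup.𝓘Λ 4 K (insert 0 (Fin.succ '' (S : Set (Fin 4))))) (hypSheaf p s.F) p).comap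
                (Spec.map (CommRingCat.ofHom ((Θ.trans (AffinePointBlowup.translateEquiv (n := 4) (Fin.cases 0 wt.2.1)) : A 4 K ≃ₐ[K] A 4 K) : A 4 K →+* A 4 K)) ≫
              AffineCoordBlowup.chartImm hB (ChartDictionary.succ_mem_centreVars (hP1 e he).1)) = hypSheaf p (PointBlowup.translate wt.2.1 (CentreBlowup.step p S e.1 e.2.1 s).F) := by
  obtain ⟨c'', Θ, rg, hs, hc, hmem, hover, hne, hreg, hsnc, hregw, hHB, hzig⟩ :=
    child_package_hereditary φ ψ ε Zc hπ hB hsq hC' M hmult s hK hS.2 hsee hT hsncZ idx cst hshape hinj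
      (hP1 e he).1 (hP1 e he).2.1 (hP1 e he).2.2.1 (Hd e) (hH1 e he)
  exact ⟨c'', rg, hreg, hsnc, hzig, hover, hne, fun wt hwt => (hregw wt hwt).2.2.2, hHB, Θ, hs, hc, hmem,
    fun wt hwt => ⟨(hregw wt hwt).1, (hregw wt hwt).2.1, (hregw wt hwt).2.2.1⟩⟩

/-- **THE CHILDREN WITH THEIR HEREDITARY WAITING REGIONS, through a given `ε`.** See the module docstring.
[cite: BierstoneGrigorievMilmanWlodarczyk2011, Def. 3.1.3 (1)–(2), (4)] [cite: Hauser2010, §§F–G] [cite: GortzWedhorn2020, Prop. 13.91] -/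
theorem joint_forest_children_hereditary [IsLocallyNoetherian Z] [IsAlgClosed K] (Zc : Z.IdealSheafData)
    (hπ : IsBlowup π Zc) (hB : IsBlowup B (AffineCoordBlowup.𝓘Λ 4 K (insert 0 (Fin.succ '' (S : Set (Fin 4))))))
    (hsq : ε.hom ≫ (B ∣_ ψ.opensRange) = (π ∣_ φ.opensRange) ≫ (φ.isoOpensRange.inv ≫ ψ.isoOpensRange.hom))
    (hC' : ((AffineCoordBlowup.𝓘Λ 4 K (insert 0 (Fin.succ '' (S : Set (Fin 4))))).comap ψ.opensRange.ι).comap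
        (φ.isoOpensRange.inv ≫ ψ.isoOpensRange.hom) = Zc.comap φ.opensRange.ι)
    (M : MarkedIdeal Z) (hmult : M.mult = p) (s : State K)
    (hK : ((controlledTransform B (AffineCoordBlowup.𝓘Λ 4 K (insert 0 (Fin.succ '' (S : Set (Fin 4)))))
        (hypSheaf p s.F) p).comap (B ⁻¹ᵁ ψ.opensRange).ι).comap ε.hom =
      (controlledTransform π Zc M.ideal p).comap (π ⁻¹ᵁ φ.opensRange).ι) (hS : IsPermissibleCentre p S s.F)
    (hsee : (AffineCoordBlowup.CΛ 4 K (insert 0 (Fin.succ '' (S : Set (Fin 4)))) : Set (P 4 K)) ⊆ Set.range ψ) (hT : IsClosed (φ '' (ψ ⁻¹' (AffineCoordBlowup.CΛ 4 K (insert 0 (Fin.succ '' (S : Set (Fin 4)))) : Set (P 4 K)))))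
    (hsncZ : HasSNCWith M.boundary Zc) (idx : Z.IdealSheafData → Fin 4) (cst : Z.IdealSheafData → K)
    (hshape : ∀ D ∈ M.boundary, ((D.support : Set Z) ∩ φ '' (ψ ⁻¹' (AffineCoordBlowup.CΛ 4 K (insert 0 (Fin.succ '' (S : Set (Fin 4)))) : Set (P 4 K)))).Nonempty →
      D.comap φ = (ofIdealTop (Ideal.span {(γ 4 K).symm (X (idx D).succ + C (cst D))})).comap ψ ∧
        (idx D ∈ S → cst D = 0))
    (hinj : ∀ D₁ ∈ M.boundary, ∀ D₂ ∈ M.boundary,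
      ((D₁.support : Set Z) ∩ φ '' (ψ ⁻¹' (AffineCoordBlowup.CΛ 4 K (insert 0 (Fin.succ '' (S : Set (Fin 4)))) : Set (P 4 K)))).Nonempty → ((D₂.support : Set Z) ∩ φ '' (ψ ⁻¹' (AffineCoordBlowup.CΛ 4 K (insert 0 (Fin.succ '' (S : Set (Fin 4)))) : Set (P 4 K)))).Nonempty →
      idx D₁ = idx D₂ → D₁ = D₂)
    (Pl : Finset (Fin 4 × (Fin 4 → K) × Finset (Fin 4)))
    (hP1 : ∀ e ∈ Pl, e.1 ∈ S ∧ e.2.1 e.1 = 0 ∧ S ⊆ e.2.2 ∧ CentreBlowup.IsEquimultiplePoint p S e.1 e.2.1 s ∧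
      IsPermissibleCentre p e.2.2 (CentreBlowup.step p S e.1 e.2.1 s).F)
    (hP2 : ∀ e ∈ Pl, ∀ e' ∈ Pl, e ≠ e' →
      (e.1 = e'.1 ∧ ∃ i ∈ e.2.2, i ∈ e'.2.2 ∧ e.2.1 i ≠ e'.2.1 i) ∨
      (e.1 ≠ e'.1 ∧ ((e'.2.1 e.1 = 0 ∧ e.1 ∈ e'.2.2) ∨ (e.2.1 e'.1 = 0 ∧ e'.1 ∈ e.2.2))))
    (Hd : Fin 4 × (Fin 4 → K) × Finset (Fin 4) → Finset (Fin 4 × (Fin 4 → K) × Finset (Fin 4)))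
    (hH1 : ∀ e ∈ Pl, ∀ wt ∈ Hd e, wt.2.1 e.1 = 0 ∧ (∀ i ∈ S, wt.2.1 i = 0) ∧ S.erase e.1 ⊆ wt.2.2 ∧ e.1 ∈ wt.2.2)
    (hH2a : ∀ e ∈ Pl, ∀ wt ∈ Hd e, ∀ e' ∈ Pl, e' ≠ e →
      (e'.1 = e.1 ∧ ∃ i ∈ wt.2.2, i ∈ e'.2.2 ∧ e.2.1 i + wt.2.1 i ≠ e'.2.1 i) ∨
      (e'.1 ≠ e.1 ∧ ((e'.2.1 e.1 = 0 ∧ e.1 ∈ e'.2.2) ∨ (e.2.1 e'.1 + wt.2.1 e'.1 = 0 ∧ e'.1 ∈ wt.2.2))))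
    (hH2c : ∀ e ∈ Pl, ∀ wt ∈ Hd e, ∀ e' ∈ Pl, ∀ wt' ∈ Hd e', (e, wt) ≠ (e', wt') →
      (e'.1 = e.1 ∧ ∃ i ∈ wt.2.2, i ∈ wt'.2.2 ∧ e.2.1 i + wt.2.1 i ≠ e'.2.1 i + wt'.2.1 i) ∨
      (e'.1 ≠ e.1 ∧ ((e'.2.1 e.1 + wt'.2.1 e.1 = 0 ∧ e.1 ∈ wt'.2.2) ∨ (e.2.1 e'.1 + wt.2.1 e'.1 = 0 ∧ e'.1 ∈ wt.2.2)))) :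
    ∃ (kid : Fin 4 × (Fin 4 → K) × Finset (Fin 4) → Closeds W)
      (rgn : Fin 4 × (Fin 4 → K) × Finset (Fin 4) → Fin 4 × (Fin 4 → K) × Finset (Fin 4) → Closeds W),
      (∀ (e : Fin 4 × (Fin 4 → K) × Finset (Fin 4)) (he : e ∈ Pl),
        Scheme.IsRegular (vanishingIdeal (kid e)).subscheme ∧
        HasSNCWith (M.transform π Zc).boundary (vanishingIdeal (kid e)) ∧
        (∃ (Y'' : Scheme.{0}) (φ'' : Y'' ⟶ W) (ψ'' : Y'' ⟶ P 4 K) (_ : IsOpenImmersion φ'') (_ : IsOpenImmersion ψ''),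
          (M.transform π Zc).ideal.comap φ'' = (hypSheaf p (CentreBlowup.step p S e.1 e.2.1 s).F).comap ψ'' ∧
          (vanishingIdeal (kid e)).comap φ'' =
            (AffineCoordBlowup.𝓘Λ 4 K (insert 0 (Fin.succ '' ((e.2.2 : Finset (Fin 4)) : Set (Fin 4))))).comap ψ'' ∧
          (kid e : Set W) ⊆ Set.range φ'' ∧
          (AffineCoordBlowup.CΛ 4 K (insert 0 (Fin.succ '' ((e.2.2 : Finset (Fin 4)) : Set (Fin 4)))) : Set (P 4 K)) ⊆ Set.range ψ'' ∧
          (∃ (idx₂ : W.IdealSheafData → Fin 4) (cst₂ : W.IdealSheafData → K),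
            (∀ D₂ ∈ (M.transform π Zc).boundary,
              ((D₂.support : Set W) ∩ φ'' '' (ψ'' ⁻¹' (AffineCoordBlowup.CΛ 4 K (insert 0 (Fin.succ '' ((e.2.2 : Finset (Fin 4)) : Set (Fin 4)))) : Set (P 4 K)))).Nonempty →
              D₂.comap φ'' = (ofIdealTop (Ideal.span {(γ 4 K).symm (X (idx₂ D₂).succ + C (cst₂ D₂))})).comap ψ'' ∧
                (idx₂ D₂ ∈ e.2.2 → cst₂ D₂ = 0)) ∧
            (∀ D₁ ∈ (M.transform π Zc).boundary, ∀ D₂ ∈ (M.transform π Zc).boundary,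
              ((D₁.support : Set W) ∩ φ'' '' (ψ'' ⁻¹' (AffineCoordBlowup.CΛ 4 K (insert 0 (Fin.succ '' ((e.2.2 : Finset (Fin 4)) : Set (Fin 4)))) : Set (P 4 K)))).Nonempty →
              ((D₂.support : Set W) ∩ φ'' '' (ψ'' ⁻¹' (AffineCoordBlowup.CΛ 4 K (insert 0 (Fin.succ '' ((e.2.2 : Finset (Fin 4)) : Set (Fin 4)))) : Set (P 4 K)))).Nonempty →
              idx₂ D₁ = idx₂ D₂ → D₁ = D₂)) ∧
          ∀ wt ∈ Hd e, (rgn e wt : Set W) = φ'' '' (ψ'' ⁻¹' {x : P 4 K | (X 0 : A 4 K) ∈ x.asIdeal ∧ ∀ i ∈ wt.2.2, (X i.succ - C (wt.2.1 i) : A 4 K) ∈ x.asIdeal}) ∧ {x : P 4 K | (X 0 : A 4 K) ∈ x.asIdeal ∧ ∀ i ∈ wt.2.2, (X i.succ - C (wt.2.1 i) : A 4 K) ∈ x.asIdeal} ⊆ Set.range ψ'') ∧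
        (kid e : Set W) ⊆ π ⁻¹' (φ '' (ψ ⁻¹' (AffineCoordBlowup.CΛ 4 K (insert 0 (Fin.succ '' (S : Set (Fin 4)))) : Set (P 4 K)))) ∧
        (kid e : Set W).Nonempty ∧
        (∀ wt ∈ Hd e, (rgn e wt : Set W) ⊆ π ⁻¹' (φ '' (ψ ⁻¹' (AffineCoordBlowup.CΛ 4 K (insert 0 (Fin.succ '' (S : Set (Fin 4)))) : Set (P 4 K))))) ∧
        ((∀ D ∈ M.boundary, ((D.support : Set Z) ∩ φ '' (ψ ⁻¹' (AffineCoordBlowup.CΛ 4 K (insert 0 (Fin.succ '' (S : Set (Fin 4)))) : Set (P 4 K)))).Nonempty → idx D ∈ S) →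
          (∀ D₂ ∈ (M.transform π Zc).boundary, ((D₂.support : Set W) ∩ (kid e : Set W)).Nonempty →
            (kid e : Set W) ⊆ D₂.support) ∧
          (∀ wt ∈ Hd e, ∀ D₂ ∈ (M.transform π Zc).boundary,
            Disjoint (D₂.support : Set W) (rgn e wt : Set W) ∨
              ((kid e : Set W) ⊆ D₂.support ∧ (rgn e wt : Set W) ⊆ D₂.support))) ∧
        ∃ Θ : A 4 K ≃ₐ[K] A 4 K, (∀ i : Fin 4, Θ (X i.succ) = X i.succ + C (e.2.1 i)) ∧
          (controlledTransform B (AffineCoordBlowup.𝓘Λ 4 K (insert 0 (Fin.succ '' (S : Set (Fin 4))))) (hypSheaf p s.F) p).comap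
              (Spec.map (CommRingCat.ofHom ((Θ : A 4 K ≃ₐ[K] A 4 K) : A 4 K →+* A 4 K)) ≫
              AffineCoordBlowup.chartImm hB (ChartDictionary.succ_mem_centreVars (hP1 e he).1)) = hypSheaf p (CentreBlowup.step p S e.1 e.2.1 s).F ∧
          (∀ (w : W) (hwV : w ∈ π ⁻¹ᵁ φ.opensRange), w ∈ (kid e : Set W) ↔
            ((B ⁻¹ᵁ ψ.opensRange).ι (ε.hom ⟨w, hwV⟩) : Bl) ∈ (Spec.map (CommRingCat.ofHom ((Θ : A 4 K ≃ₐ[K] A 4 K) : A 4 K →+* A 4 K)) ≫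
              AffineCoordBlowup.chartImm hB (ChartDictionary.succ_mem_centreVars (hP1 e he).1)) '' (AffineCoordBlowup.CΛ 4 K (insert 0 (Fin.succ '' ((e.2.2 : Finset (Fin 4)) : Set (Fin 4)))) : Set (P 4 K))) ∧
          ∀ wt ∈ Hd e,
            (∀ (w : W) (hwV : w ∈ π ⁻¹ᵁ φ.opensRange), w ∈ (rgn e wt : Set W) ↔
              ((B ⁻¹ᵁ ψ.opensRange).ι (ε.hom ⟨w, hwV⟩) : Bl) ∈ (Spec.map (CommRingCat.ofHom ((Θ.trans (AffinePointBlowup.translateEquiv (n := 4) (Fin.cases 0 wt.2.1)) : A 4 K ≃ₐ[K] A 4 K) : A 4 K →+* A 4 K)) ≫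
              AffineCoordBlowup.chartImm hB (ChartDictionary.succ_mem_centreVars (hP1 e he).1)) '' (AffineCoordBlowup.CΛ 4 K (insert 0 (Fin.succ '' ((wt.2.2 : Finset (Fin 4)) : Set (Fin 4)))) : Set (P 4 K))) ∧
            (∀ i : Fin 4, (Θ.trans (AffinePointBlowup.translateEquiv (n := 4) (Fin.cases 0 wt.2.1))) (X i.succ) = X i.succ + C (e.2.1 i + wt.2.1 i)) ∧
            (controlledTransform B (AffineCoordBlowup.𝓘Λ 4 K (insert 0 (Fin.succ '' (S : Set (Fin 4))))) (hypSheaf p s.F) p).comap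
                (Spec.map (CommRingCat.ofHom ((Θ.trans (AffinePointBlowup.translateEquiv (n := 4) (Fin.cases 0 wt.2.1)) : A 4 K ≃ₐ[K] A 4 K) : A 4 K →+* A 4 K)) ≫
              AffineCoordBlowup.chartImm hB (ChartDictionary.succ_mem_centreVars (hP1 e he).1)) = hypSheaf p (PointBlowup.translate wt.2.1 (CentreBlowup.step p S e.1 e.2.1 s).F)) ∧
      (∀ e ∈ Pl, ∀ e' ∈ Pl, e ≠ e' → Disjoint (kid e : Set W) (kid e' : Set W)) ∧
      (∀ e ∈ Pl, ∀ wt ∈ Hd e, ∀ e' ∈ Pl, e' ≠ e → Disjoint (rgn e wt : Set W) (kid e' : Set W)) ∧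
      (∀ e ∈ Pl, ∀ wt ∈ Hd e, ∀ e' ∈ Pl, ∀ wt' ∈ Hd e', (e, wt) ≠ (e', wt') →
        Disjoint (rgn e wt : Set W) (rgn e' wt' : Set W)) := by
  classical
  haveI : IsProper π := hπ.isProper
  haveI : IsLocallyNoetherian W := LocallyOfFiniteType.isLocallyNoetherian π
  have kidEx := fun (e : Fin 4 × (Fin 4 → K) × Finset (Fin 4)) (he : e ∈ Pl) =>
    child_package_hereditary₂ φ ψ ε Zc hπ hB hsq hC' M hmult s hK hS hsee hT hsncZ idx cst hshape hinj Pl hP1 Hd hH1 he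
  let kid : Fin 4 × (Fin 4 → K) × Finset (Fin 4) → Closeds W := fun e =>
    if he : e ∈ Pl then (kidEx e he).choose else ⊥
  let rgn : Fin 4 × (Fin 4 → K) × Finset (Fin 4) → Fin 4 × (Fin 4 → K) × Finset (Fin 4) → Closeds W := fun e =>
    if he : e ∈ Pl then (kidEx e he).choose_spec.choose else fun _ => ⊥
  have hkid : ∀ e (he : e ∈ Pl), kid e = (kidEx e he).choose := fun e he => dif_pos he
  have hrgn : ∀ e (he : e ∈ Pl), rgn e = (kidEx e he).choose_spec.choose := fun e he => dif_pos he
  have hwV_of : ∀ {Aset : Set W}, Aset ⊆ π ⁻¹' (φ '' (ψ ⁻¹' (AffineCoordBlowup.CΛ 4 K (insert 0 (Fin.succ '' (S : Set (Fin 4)))) : Set (P 4 K)))) → ∀ w ∈ Aset, w ∈ π ⁻¹ᵁ φ.opensRange := by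
    intro Aset hA w hw
    obtain ⟨y, -, hy⟩ := hA hw
    exact ⟨y, hy⟩
  refine ⟨kid, rgn, fun e he => ?_, fun e he e' he' hne => ?_, fun e he wt hwt e' he' hne => ?_,
    fun e he wt hwt e' he' wt' hwt' hne => ?_⟩
  · rw [hkid e he, hrgn e he]
    exact (kidEx e he).choose_spec.choose_spec
  · -- two children are disjoint (P2)
    rw [hkid e he, hkid e' he']
    obtain ⟨-, -, -, hover, -, -, -, Θ, hs, -, hmem, -⟩ := (kidEx e he).choose_spec.choose_spec
    obtain ⟨-, -, -, -, -, -, -, Θ', hs', -, hmem', -⟩ := (kidEx e' he').choose_spec.choose_spec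
    have hsR : ∀ k : Fin 4, (Θ : A 4 K →+* A 4 K) (X k.succ) = X k.succ + C (e.2.1 k) := fun k => hs k
    have hsR' : ∀ k : Fin 4, (Θ' : A 4 K →+* A 4 K) (X k.succ) = X k.succ + C (e'.2.1 k) := fun k => hs' k
    have hCR : ∀ r : K, (Θ : A 4 K →+* A 4 K) (C r) = C r := fun r => Θ.commutes r
    have hCR' : ∀ r : K, (Θ' : A 4 K →+* A 4 K) (C r) = C r := fun r => Θ'.commutes r
    rw [Set.disjoint_left]
    intro w hw hw'
    have hwV := hwV_of hover w hw
    have h1 := (hmem w hwV).mp hw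
    have h2 := (hmem' w hwV).mp hw'
    rcases hP2 e he e' he' hne with ⟨hjj, i, hi, hi', hbi⟩ | ⟨hjj, hcase⟩
    · have hj₁ := (hP1 e he).1
      obtain ⟨j, b, S₂⟩ := e
      obtain ⟨j', b', S₃⟩ := e'
      simp only at hjj hi hi' hbi h1 h2 hsR hsR' hj₁
      subst hjj
      exact Set.disjoint_left.mp (ChartDictionary.disjoint_image_CΛ_chart_of_ne hj₁ hCR hsR hCR' hsR' hB hi hi' hbi) h1 h2
    · rcases hcase with ⟨hb0, hjS⟩ | ⟨hb0, hjS⟩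
      · exact Set.disjoint_left.mp (ChartDictionary.disjoint_image_CΛ_chart_of_ne_chart (hP1 e he).1 (hP1 e' he').1
          hjj hsR' hb0 hB hjS) h1 h2
      · exact Set.disjoint_left.mp (ChartDictionary.disjoint_image_CΛ_chart_of_ne_chart (hP1 e' he').1 (hP1 e he).1
          (Ne.symm hjj) hsR hb0 hB hjS) h2 h1
  · -- a region and another child are disjoint (H2a)
    rw [hrgn e he, hkid e' he']
    obtain ⟨-, -, -, -, -, hoverr, -, Θ, -, -, -, hregm⟩ := (kidEx e he).choose_spec.choose_spec
    obtain ⟨-, -, -, -, -, -, -, Θ', hs', -, hmem', -⟩ := (kidEx e' he').choose_spec.choose_spec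
    obtain ⟨hmemr, hst, -⟩ := hregm wt hwt
    have hsR : ∀ k : Fin 4, ((Θ.trans (AffinePointBlowup.translateEquiv (n := 4) (Fin.cases 0 wt.2.1)) : A 4 K ≃ₐ[K] A 4 K) : A 4 K →+* A 4 K) (X k.succ) =
        X k.succ + C ((fun i => e.2.1 i + wt.2.1 i) k) := fun k => hst k
    have hsR' : ∀ k : Fin 4, (Θ' : A 4 K →+* A 4 K) (X k.succ) = X k.succ + C (e'.2.1 k) := fun k => hs' k
    have hCR : ∀ r : K, ((Θ.trans (AffinePointBlowup.translateEquiv (n := 4) (Fin.cases 0 wt.2.1)) : A 4 K ≃ₐ[K] A 4 K) : A 4 K →+* A 4 K) (C r) = C r := fun r => (Θ.trans _).commutes r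
    have hCR' : ∀ r : K, (Θ' : A 4 K →+* A 4 K) (C r) = C r := fun r => Θ'.commutes r
    rw [Set.disjoint_left]
    intro w hw hw'
    have hwV := hwV_of (hoverr wt hwt) w hw
    have h1 := (hmemr w hwV).mp hw
    have h2 := (hmem' w hwV).mp hw'
    rcases hH2a e he wt hwt e' he' hne with ⟨hjj, i, hi, hi', hbi⟩ | ⟨hjj, hcase⟩
    · have hj₁ := (hP1 e he).1
      obtain ⟨j, b, S₂⟩ := e
      obtain ⟨j', b', S₃⟩ := e'
      simp only at hjj hi hi' hbi h1 h2 hsR hsR' hj₁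
      subst hjj
      exact Set.disjoint_left.mp (ChartDictionary.disjoint_image_CΛ_chart_of_ne hj₁ hCR hsR hCR' hsR' hB hi hi' hbi) h1 h2
    · rcases hcase with ⟨hb0, hjS⟩ | ⟨hb0, hjS⟩
      · exact Set.disjoint_left.mp (ChartDictionary.disjoint_image_CΛ_chart_of_ne_chart (hP1 e he).1 (hP1 e' he').1
          (Ne.symm hjj) hsR' hb0 hB hjS) h1 h2
      · exact Set.disjoint_left.mp (ChartDictionary.disjoint_image_CΛ_chart_of_ne_chart (hP1 e' he').1 (hP1 e he).1
          hjj hsR hb0 hB hjS) h2 h1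
  · -- two regions are disjoint (H2c)
    rw [hrgn e he, hrgn e' he']
    obtain ⟨-, -, -, -, -, hoverr, -, Θ, -, -, -, hregm⟩ := (kidEx e he).choose_spec.choose_spec
    obtain ⟨-, -, -, -, -, -, -, Θ', -, -, -, hregm'⟩ := (kidEx e' he').choose_spec.choose_spec
    obtain ⟨hmemr, hst, -⟩ := hregm wt hwt
    obtain ⟨hmemr', hst', -⟩ := hregm' wt' hwt'
    have hsR : ∀ k : Fin 4, ((Θ.trans (AffinePointBlowup.translateEquiv (n := 4) (Fin.cases 0 wt.2.1)) : A 4 K ≃ₐ[K] A 4 K) : A 4 K →+* A 4 K) (X k.succ) =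
        X k.succ + C ((fun i => e.2.1 i + wt.2.1 i) k) := fun k => hst k
    have hsR' : ∀ k : Fin 4, ((Θ'.trans (AffinePointBlowup.translateEquiv (n := 4) (Fin.cases 0 wt'.2.1)) : A 4 K ≃ₐ[K] A 4 K) : A 4 K →+* A 4 K) (X k.succ) =
        X k.succ + C ((fun i => e'.2.1 i + wt'.2.1 i) k) := fun k => hst' k
    have hCR : ∀ r : K, ((Θ.trans (AffinePointBlowup.translateEquiv (n := 4) (Fin.cases 0 wt.2.1)) : A 4 K ≃ₐ[K] A 4 K) : A 4 K →+* A 4 K) (C r) = C r := fun r => (Θ.trans _).commutes r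
    have hCR' : ∀ r : K, ((Θ'.trans (AffinePointBlowup.translateEquiv (n := 4) (Fin.cases 0 wt'.2.1)) : A 4 K ≃ₐ[K] A 4 K) : A 4 K →+* A 4 K) (C r) = C r :=
      fun r => (Θ'.trans _).commutes r
    rw [Set.disjoint_left]
    intro w hw hw'
    have hwV := hwV_of (hoverr wt hwt) w hw
    have h1 := (hmemr w hwV).mp hw
    have h2 := (hmemr' w hwV).mp hw'
    rcases hH2c e he wt hwt e' he' wt' hwt' hne with ⟨hjj, i, hi, hi', hbi⟩ | ⟨hjj, hcase⟩
    · have hj₁ := (hP1 e he).1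
      obtain ⟨j, b, S₂⟩ := e
      obtain ⟨j', b', S₃⟩ := e'
      simp only at hjj hi hi' hbi h1 h2 hsR hsR' hj₁
      subst hjj
      exact Set.disjoint_left.mp (ChartDictionary.disjoint_image_CΛ_chart_of_ne hj₁ hCR hsR hCR' hsR' hB hi hi' hbi) h1 h2
    · rcases hcase with ⟨hb0, hjS⟩ | ⟨hb0, hjS⟩
      · exact Set.disjoint_left.mp (ChartDictionary.disjoint_image_CΛ_chart_of_ne_chart (hP1 e he).1 (hP1 e' he').1
          (Ne.symm hjj) hsR' hb0 hB hjS) h1 h2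
      · exact Set.disjoint_left.mp (ChartDictionary.disjoint_image_CΛ_chart_of_ne_chart (hP1 e' he').1 (hP1 e he).1
          hjj hsR hb0 hB hjS) h2 h1

end ChildrenH

end Equimultiple

end Summit.ResolutionOfSingularities.ResolutionOfSingularities.Theorems.PIDim4

end
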